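import Mathlib
import Literature.MathematicalPhysics.QuantumFieldTheory.Balaban1983to89.B9Eq386Neumann

/-!
# `Balaban1983to89.B9Eq386NeumannAnalytic` — B9 p. 402 (after (3.64)) and p. 407 (after (3.86)): *«Each term in the series is
# analytic in A on the domain (3.37), and the series is convergent uniformly, hence G′(U′U) is an analytic function of A also»* —
# the ANALYTICITY sentence of the Neumann-series step of Theorem 3.4, kernel-checked for the tree's series `B9Eq386Neumann.gNew`

statement-level skeleton of published theorems with citation tags; proofs where landed; nothing here is a claim about the
Yang–Mills mass gap

CITATION HEADER (lean-in-tree rule 2026-08-18).  T. Bałaban, *Propagators for lattice gauge theories in a background field*,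
Commun. Math. Phys. **99** (1985) 389–434 [Balaban1985BackgroundPropagators] (cell paper B9; PDF held
`paper:balaban1985-cmp99-background-propagators`, journal page = PDF page + 388).  WHAT IS REPRODUCED: the two printed
inferences «each term analytic + Neumann series convergent ⟹ the extended operator is analytic in A»:

* p. 402 [PDF 14], after (3.64) (verbatim, as quoted in the tree file `B9Eq360Vprime`): *"This implies the existence of the
  operator G′(U′U) and the equality G′(U′U) = G′(U)(I − V′(A)G′(U))^{−1} = Σ_{n=0}^{∞} G′(U)(V′(A)G′(U))ⁿ. (3.64)  Each term in
  the series is analytic in A on the domain (3.37), and the series is convergent uniformly, hence G′(U′U) is an analytic function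
  of A also."*
* p. 407 [PDF 19], after (3.86) (verbatim, as quoted in the tree file `B9Eq386Neumann`): *"… hence V(A)G(U) is a small operator
  in supremum norm, and we have G(U′U) = G(U)(I − V(A)G(U))^{−1} = Σ_{n=0}^∞ G(U)(V(A)G(U))^n, (3.86) and convergence is in the
  operator norm for α₁ sufficiently mall [sic]. Each term in the series is an analytic function of A in the domain (3.37). …
  Thus Theorem 3.4 is proved, assuming that Theorems 3.1–3.3 hold."*  Theorem 3.4, p. 400 [PDF 12]: *"There exists a positive
  constant a₁ such that the operators G′(U), (Q′(U)G′²(U)Q′\*(U))^{−1}, R(U), G(U) extend to configurations U′U for α₁ ≦ a₁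
  as analytic functions of A."*

Both series are THE SAME tree object: `B9Eq386Neumann.gNew G V = G * ∑' n, (V * G) ^ n` ((3.86); the (3.64) operator
`B9Eq360Vprime.gPrimeExt Gp Vp` is `gNew Gp Vp` by definition — its `eq364` is `rfl`), and both sibling files list
«analyticity in A … of the terms of the series» among the items NOT PROVED there (by design).  THIS FILE proves exactly that
item, ABSTRACTLY, in the generality the two files use (a normed ring `R` with summable geometric series which is a normed
algebra over a nontrivially normed field `𝕜` — `𝕜 = ℂ` in print — and a map `V : E → R` from a normed `𝕜`-space `E` of
«configurations A»):

* `analyticAt_term` — *"Each term in the series is analytic in A"*: if `V` is analytic at `A` then `B ↦ G(V(B)G)ⁿ` is.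
* `eventually_norm_lt_one` — the smallness `‖V(A)G‖ < 1` is an OPEN condition in `A` (continuity of `V`).
* `analyticAt_inverse_one_sub_comp` — `B ↦ (I − V(B)G)^{−1}` (`Ring.inverse`) is analytic at `A` when `V` is and `‖V(A)G‖ < 1`
  (Mathlib's `analyticAt_inverse` at the unit `1 − V(A)G`, composed).
* **`analyticAt_gNew_comp`** — *"hence G(U′U) is an analytic function of A also"*: `B ↦ gNew G (V B)` is analytic at `A` when
  `V` is analytic at `A` and `‖V(A)G‖ < 1` (near `A` the series equals `G(I − V(B)G)^{−1}`, `B9Eq386Neumann.gNew_eq_mul_inverse`).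
* `analyticOnNhd_gNew_comp` / `analyticOnNhd_gNew_comp_of_le_mul` — the same on a set `D` («the domain (3.37)») under
  `‖V(A)G‖ < 1` resp. the (3.85)-shape smallness `‖V(A)G‖ ≤ cα₁`, `cα₁ < 1`, for all `A ∈ D`.
* `norm_gNew_comp_sub_partial_le_uniform` — *"the series is convergent uniformly"*: on `D` with `‖V(A)G‖ ≤ q < 1` the N-th
  remainder is `≤ ‖G‖·qᴺ·(‖1‖ − 1 + (1 − q)⁻¹)`, a bound independent of `A` (from `B9Eq386Neumann.norm_gNew_sub_partial_le`).

NOT PROVED HERE (binders, said once): that `A ↦ V′(A)` resp. `A ↦ V(A) = V₃(A) + P₁(A) + P₂(A)` IS analytic on the domain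
(3.37) (p. 402 «It is an analytic function of A on the domain (3.37), for α₁ sufficiently small»; p. 407 «V₃(A), P₁(A), P₂(A)
depend analytically on A» — the tree has the `V₃` part: `B9Eq373V3Analytic`), the smallness (3.63)/(3.85) itself, and the
remaining clauses of Theorem 3.4 («satisfy all the inequalities of Theorems 3.1–3.3») — see `B9Thm34Ext`, `B9Eq360Vprime` §4.
No `def … : Prop` hypothesis is introduced; every declaration is a theorem proved from Mathlib and `B9Eq386Neumann` (BY NAME).

PROVENANCE.  Filed by the `pub-balaban` NE9 owner lineage (b2b-balaban-t4-ne9-p1, gen 53): Theorem 3.4's «analytic functions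
of A» is the printed statement behind the COMPLEX-CHART typing of binder row NE9's species data (WALL-NE9-P1 §3 (vi), request
D-8 (v): the complex background family as an object); this file is the kernel form of its Neumann-series inference, offered to
the `lit-balaban` B9 row owners (rows B9.Eq3.62 / B9.Eq3.86) to fold or re-stem at will.  HONEST FRAMING (pub-balaban T⁴ cell):
bookkeeping of a printed proof step; it moves no class of row NE9 (the species' analytic fields stay an (H∃)-class displayed
hypothesis until the lattice instance exists); NE9 NOT PRINTED ∕ NOT PROVED; spine PROVED 0∕9; rung (B)+1 finite T⁴ — NOT
infinite volume, NOT mass gap, NOT Clay.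
-/

namespace Literature.MathematicalPhysics.QuantumFieldTheory.Balaban1983to89.B9Eq386NeumannAnalytic

open scoped Topology
open Filter
open Literature.MathematicalPhysics.QuantumFieldTheory.Balaban1983to89.B9Eq386Neumann (gNew gNew_eq_mul_inverse
  norm_gNew_le norm_gNew_sub_partial_le)

variable {𝕜 : Type*} [NontriviallyNormedField 𝕜]
variable {R : Type*} [NormedRing R] [NormedAlgebra 𝕜 R]
variable {E : Type*} [NormedAddCommGroup E] [NormedSpace 𝕜 E]

/-- *"Each term in the series is analytic in A"* (p. 402 after (3.64); p. 407 after (3.86)): if the perturbation `A ↦ V(A)` is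
analytic at `A`, so is `B ↦ G(V(B)G)ⁿ` for every `n`. [cite: Balaban1985BackgroundPropagators, (3.86) p.407] -/
theorem analyticAt_term (G : R) {V : E → R} {A : E} (hV : AnalyticAt 𝕜 V A) (n : ℕ) :
    AnalyticAt 𝕜 (fun B => G * (V B * G) ^ n) A :=
  analyticAt_const.mul ((hV.mul analyticAt_const).pow n)

/-- The partial sums `Σ_{n<N} G(V(B)G)ⁿ` are analytic at `A` when `V` is. [cite: Balaban1985BackgroundPropagators, (3.86) p.407] -/
theorem analyticAt_partialSum (G : R) {V : E → R} {A : E} (hV : AnalyticAt 𝕜 V A) (N : ℕ) :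
    AnalyticAt 𝕜 (fun B => ∑ n ∈ Finset.range N, G * (V B * G) ^ n) A :=
  Finset.analyticAt_fun_sum _ fun n _ => analyticAt_term G hV n

/-- The smallness *"V(A)G(U) is a small operator"* (`‖V(A)G‖ < 1`) is an open condition in `A`: it persists near `A` as soon
as `V` is continuous at `A`. [folklore] [cite: Balaban1985BackgroundPropagators, (3.86) p.407] -/
theorem eventually_norm_lt_one {V : E → R} {A : E} (hV : ContinuousAt V A) (G : R) (h : ‖V A * G‖ < 1) :
    ∀ᶠ B in 𝓝 A, ‖V B * G‖ < 1 :=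
  ((hV.mul continuousAt_const).norm).eventually_lt continuousAt_const h

variable [HasSummableGeomSeries R]

/-- `B ↦ (I − V(B)G)^{−1}` (*"the inverse is given by a convergent Neumann series"*) is analytic at `A` if `V` is analytic at
`A` and `‖V(A)G‖ < 1`: Mathlib's analyticity of `Ring.inverse` at the unit `1 − V(A)G`, composed with `B ↦ 1 − V(B)G`.
[cite: Balaban1985BackgroundPropagators, (3.64) p.402] -/
theorem analyticAt_inverse_one_sub_comp (G : R) {V : E → R} {A : E} (hV : AnalyticAt 𝕜 V A) (h : ‖V A * G‖ < 1) :
    AnalyticAt 𝕜 (fun B => Ring.inverse (1 - V B * G)) A := by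
  have hu : IsUnit (1 - V A * G) := isUnit_one_sub_of_norm_lt_one h
  have h1 : AnalyticAt 𝕜 (fun B => 1 - V B * G) A := analyticAt_const.sub (hV.mul analyticAt_const)
  have h2 : AnalyticAt 𝕜 Ring.inverse (↑hu.unit : R) := analyticAt_inverse (𝕜 := 𝕜) hu.unit
  exact h2.comp_of_eq h1 hu.unit_spec.symm

/-- **p. 402 / p. 407: *"hence G′(U′U)"* (resp. `G(U′U)`) *"is an analytic function of A also"***, for the tree's series
`gNew G V = G·Σₙ(VG)ⁿ` of (3.86) (= `B9Eq360Vprime.gPrimeExt` of (3.64) by definition): if `A ↦ V(A)` is analytic at `A` and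
`‖V(A)G‖ < 1`, then `B ↦ gNew G (V B)` is analytic at `A`.  Proof as printed, in closed form: near `A` the smallness persists
(`eventually_norm_lt_one`), there the series IS `G(I − V(B)G)^{−1}` (`B9Eq386Neumann.gNew_eq_mul_inverse`), which is analytic
(`analyticAt_inverse_one_sub_comp`). [cite: Balaban1985BackgroundPropagators, (3.86) p.407] -/
theorem analyticAt_gNew_comp (G : R) {V : E → R} {A : E} (hV : AnalyticAt 𝕜 V A) (h : ‖V A * G‖ < 1) :
    AnalyticAt 𝕜 (fun B => gNew G (V B)) A := by
  have hev : (fun B => G * Ring.inverse (1 - V B * G)) =ᶠ[𝓝 A] fun B => gNew G (V B) := by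
    filter_upwards [eventually_norm_lt_one hV.continuousAt G h] with B hB
    exact (gNew_eq_mul_inverse G (V B) hB).symm
  exact (analyticAt_const.mul (analyticAt_inverse_one_sub_comp G hV h)).congr hev

/-- The same on a set `D` of configurations (*"on the domain (3.37)"*): `V` analytic at every point of `D` and `‖V(A)G‖ < 1`
on `D` give `B ↦ gNew G (V B)` analytic at every point of `D`. [cite: Balaban1985BackgroundPropagators, (3.86) p.407] -/
theorem analyticOnNhd_gNew_comp (G : R) {V : E → R} {D : Set E} (hV : AnalyticOnNhd 𝕜 V D)
    (h : ∀ A ∈ D, ‖V A * G‖ < 1) : AnalyticOnNhd 𝕜 (fun B => gNew G (V B)) D :=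
  fun A hA => analyticAt_gNew_comp G (hV A hA) (h A hA)

/-- The same under the (3.63)/(3.85)-SHAPE smallness *"|V(A)G(U)J| ≤ O(1)α₁|J| … for α₁ sufficiently small"*: a uniform bound
`‖V(A)G‖ ≤ cα₁` on `D` with `cα₁ < 1`. [cite: Balaban1985BackgroundPropagators, (3.85)–(3.86) p.407] -/
theorem analyticOnNhd_gNew_comp_of_le_mul (G : R) {V : E → R} {D : Set E} (hV : AnalyticOnNhd 𝕜 V D) (c α₁ : ℝ)
    (hVG : ∀ A ∈ D, ‖V A * G‖ ≤ c * α₁) (hα : c * α₁ < 1) : AnalyticOnNhd 𝕜 (fun B => gNew G (V B)) D :=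
  analyticOnNhd_gNew_comp G hV fun A hA => (hVG A hA).trans_lt hα

omit [NormedAlgebra 𝕜 R] [NormedAddCommGroup E] [NormedSpace 𝕜 E] in
/-- *"the series is convergent uniformly"* (p. 402) / *"convergence is in the operator norm"* (p. 407), quantified: on a set `D`
where `‖V(A)G‖ ≤ q < 1` the `N`-th remainder of the series is at most `‖G‖·qᴺ·(‖1‖ − 1 + (1 − q)⁻¹)` — a bound independent of
`A ∈ D`. [cite: Balaban1985BackgroundPropagators, (3.86) p.407] -/
theorem norm_gNew_comp_sub_partial_le_uniform (G : R) {V : E → R} {D : Set E} {q : ℝ} (hq : q < 1)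
    (hVG : ∀ A ∈ D, ‖V A * G‖ ≤ q) (N : ℕ) {A : E} (hA : A ∈ D) :
    ‖gNew G (V A) - ∑ n ∈ Finset.range N, G * (V A * G) ^ n‖ ≤ ‖G‖ * q ^ N * (‖(1 : R)‖ - 1 + (1 - q)⁻¹) := by
  have hq0 : 0 ≤ q := (norm_nonneg _).trans (hVG A hA)
  have hlt : ‖V A * G‖ < 1 := (hVG A hA).trans_lt hq
  -- the remainder against the pointwise ratio `‖V(A)G‖`
  have key : ‖gNew G (V A) - ∑ n ∈ Finset.range N, G * (V A * G) ^ n‖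
      ≤ ‖G‖ * ‖V A * G‖ ^ N * (‖(1 : R)‖ - 1 + (1 - ‖V A * G‖)⁻¹) := by
    have h3 : 0 ≤ ‖(1 : R)‖ - 1 + (1 - ‖V A * G‖)⁻¹ := by
      have : (1 : ℝ) ≤ (1 - ‖V A * G‖)⁻¹ := one_le_inv_iff₀.mpr ⟨by linarith, by linarith [norm_nonneg (V A * G)]⟩
      linarith [norm_nonneg (1 : R)]
    cases N with
    | zero =>
      simpa only [Finset.range_zero, Finset.sum_empty, sub_zero, pow_zero, mul_one] using norm_gNew_le G (V A) hlt
    | succ n =>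
      refine (norm_gNew_sub_partial_le G (V A) hlt (n + 1)).trans ?_
      exact mul_le_mul_of_nonneg_right
        (mul_le_mul_of_nonneg_left (norm_pow_le' _ (Nat.succ_pos n)) (norm_nonneg _)) h3
  -- monotonicity of the bound in the ratio, `‖V(A)G‖ ≤ q < 1`
  refine key.trans ?_
  have h1 : ‖V A * G‖ ^ N ≤ q ^ N := pow_le_pow_left₀ (norm_nonneg _) (hVG A hA) N
  have h2 : (1 - ‖V A * G‖)⁻¹ ≤ (1 - q)⁻¹ := inv_anti₀ (by linarith) (by linarith [hVG A hA])
  have h3 : 0 ≤ ‖(1 : R)‖ - 1 + (1 - ‖V A * G‖)⁻¹ := by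
    have : (1 : ℝ) ≤ (1 - ‖V A * G‖)⁻¹ := one_le_inv_iff₀.mpr ⟨by linarith, by linarith [norm_nonneg (V A * G)]⟩
    linarith [norm_nonneg (1 : R)]
  calc ‖G‖ * ‖V A * G‖ ^ N * (‖(1 : R)‖ - 1 + (1 - ‖V A * G‖)⁻¹)
      ≤ ‖G‖ * q ^ N * (‖(1 : R)‖ - 1 + (1 - ‖V A * G‖)⁻¹) :=
        mul_le_mul_of_nonneg_right (mul_le_mul_of_nonneg_left h1 (norm_nonneg _)) h3
    _ ≤ ‖G‖ * q ^ N * (‖(1 : R)‖ - 1 + (1 - q)⁻¹) :=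
        mul_le_mul_of_nonneg_left (by linarith) (mul_nonneg (norm_nonneg _) (pow_nonneg hq0 _))

end Literature.MathematicalPhysics.QuantumFieldTheory.Balaban1983to89.B9Eq386NeumannAnalytic
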